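import Literature.NumberTheory.LFunctions.AbelianFrobeniusDensity
import HarnessLib

/-!
# `CubicEscape`, part 1: the subgroup-orthogonality lever

Topic `Summits/QuantumAdvantage/QuantumAdvantage/Theorems`, helper for the crux `DegreeOnePrimesEscape`
(stmt-QuantumAdvantage-11543) of route `LinnikCubicClassGroups`; cell B2b-1 (linnik-cubic), PART B.
HONEST FRAMING: the value of this file is a THEOREM (kernel-checked lemmas) — not summit progress.

Copied (attributed) from the skeleton of line `subgroup-orthogonality-escape`
(`Cruxes/DegreeOnePrimesEscape/Lines/subgroup-orthogonality-escape.lean`, §2–§3, second lead 2026-08-16)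
so that the per-field composition `escape_of_inputs` (sequel file `…CubicEscape.lean`) can be IMPORTED:

* the lever — subgroup orthogonality in dual form (`index_mul_sum_filter_mem_le`): if every
  non-trivial character trivial on `M` has `∑_g Re χ(g) a(g) ≤ B` then
  `[G:M] ∑_{g ∈ M} a(g) ≤ ∑_g a(g) + ([G:M] − 1) B`; the lifted characters are written with the tree's
  `AbelianDensity.toMulHom` (no new definition). (The numerical size lemmas of the skeleton's §3 are
  already landed as `Dock.size_ineq`, `Dock.pow_bound` in `…Composition.lean`.)
-/

noncomputable section


namespace Summit.QuantumAdvantage.QuantumAdvantage.Theorems.DegreeOnePrimesEscape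

namespace CubicEscape

/-! ## §1 The lever: subgroup orthogonality in dual form (finite abelian groups) -/

section Orthogonality

variable {G : Type*} [CommGroup G]

open Literature.NumberTheory.LFunctions.AbelianDensity (toMulHom toMulHom_apply)

/-- The character of `G` lifted from an additive character `ψ` of `G ⧸ M` is trivial on `M`. [folklore] -/
theorem liftChar_apply_of_mem (M : Subgroup G) (ψ : AddChar (Additive (G ⧸ M)) ℂ) {g : G}
    (hg : g ∈ M) : ((toMulHom ψ).comp (QuotientGroup.mk' M)).toHomUnits g = 1 := by
  ext
  rw [MonoidHom.coe_toHomUnits, MonoidHom.comp_apply, QuotientGroup.mk'_apply, toMulHom_apply,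
    (QuotientGroup.eq_one_iff g).mpr hg, ofMul_one, AddChar.map_zero_eq_one, Units.val_one]

/-- The lift of a non-trivial character of `G ⧸ M` is non-trivial. [folklore] -/
theorem liftChar_ne_one (M : Subgroup G) {ψ : AddChar (Additive (G ⧸ M)) ℂ} (hψ : ψ ≠ 0) :
    ((toMulHom ψ).comp (QuotientGroup.mk' M)).toHomUnits ≠ 1 := by
  intro h
  apply hψ
  rw [AddChar.eq_zero_iff]
  intro q
  obtain ⟨g, hg⟩ : ∃ g : G, (g : G ⧸ M) = Additive.toMul q := QuotientGroup.mk_surjective _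
  have h1 := congrArg (fun χ : G →* ℂˣ => ((χ g : ℂˣ) : ℂ)) h
  simp only [MonoidHom.coe_toHomUnits, MonoidHom.comp_apply, QuotientGroup.mk'_apply, toMulHom_apply,
    MonoidHom.one_apply, Units.val_one] at h1
  rwa [hg, ofMul_toMul] at h1

open scoped Classical in
/-- `∑_ψ Re ψ(ḡ) = [G:M]·[g ∈ M]` over the characters of `G ⧸ M`. [folklore] -/
theorem sum_re_addChar_quotient [Finite G] (M : Subgroup G) (g : G) :
    ∑ ψ : AddChar (Additive (G ⧸ M)) ℂ, (ψ (Additive.ofMul (g : G ⧸ M))).re =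
      if g ∈ M then (M.index : ℝ) else 0 := by
  classical
  haveI : Fintype G := Fintype.ofFinite G
  have h := AddChar.sum_apply_eq_ite (α := Additive (G ⧸ M)) (Additive.ofMul (g : G ⧸ M))
  rw [← Complex.re_sum]
  have hiff : (Additive.ofMul (g : G ⧸ M) = 0) ↔ g ∈ M := by
    rw [ofMul_eq_zero, QuotientGroup.eq_one_iff]
  have hcard : (Fintype.card (Additive (G ⧸ M)) : ℝ) = (M.index : ℝ) := by
    rw [Subgroup.index_eq_card, Nat.card_eq_fintype_card,
      Fintype.card_congr (Additive.ofMul (α := G ⧸ M)).symm]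
  by_cases hg : g ∈ M
  · rw [if_pos hg]
    have h' : ∑ ψ : AddChar (Additive (G ⧸ M)) ℂ, ψ (Additive.ofMul (g : G ⧸ M)) =
        (Fintype.card (Additive (G ⧸ M)) : ℂ) := by
      rw [h, if_pos (hiff.mpr hg)]
    rw [h', Complex.natCast_re, hcard]
  · rw [if_neg hg]
    have h' : ∑ ψ : AddChar (Additive (G ⧸ M)) ℂ, ψ (Additive.ofMul (g : G ⧸ M)) = 0 := by
      rw [h, if_neg (mt hiff.mp hg)]
    rw [h', Complex.zero_re]

/-- The number of characters of `G ⧸ M` is the index. [folklore] -/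
theorem card_addChar_quotient [Finite G] (M : Subgroup G) :
    Fintype.card (AddChar (Additive (G ⧸ M)) ℂ) = M.index := by
  classical
  haveI : Fintype G := Fintype.ofFinite G
  rw [AddChar.card_eq, Subgroup.index_eq_card, Nat.card_eq_fintype_card,
    Fintype.card_congr (Additive.ofMul (α := G ⧸ M)).symm]

open scoped Classical in
/-- **Subgroup orthogonality, dual form.** For weights `a : G → ℝ` on a finite abelian group and a
subgroup `M`: if every NONTRIVIAL character trivial on `M` satisfies the one-sided bound
`∑_g Re χ(g)·a(g) ≤ B`, then `[G:M] · ∑_{g ∈ M} a(g) ≤ ∑_g a(g) + ([G:M] − 1)·B`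
(expand `1_M = [G:M]⁻¹ ∑_{χ ∈ M^⊥} χ` and separate `χ = 1`). [folklore] -/
theorem index_mul_sum_filter_mem_le [Fintype G] (M : Subgroup G) (a : G → ℝ) (B : ℝ)
    (hB : ∀ χ : G →* ℂˣ, χ ≠ 1 → (∀ g ∈ M, χ g = 1) →
      ∑ g, ((χ g : ℂˣ) : ℂ).re * a g ≤ B) :
    (M.index : ℝ) * ∑ g ∈ Finset.univ.filter (· ∈ M), a g ≤
      ∑ g, a g + ((M.index : ℝ) - 1) * B := by
  classical
  have h1 : (M.index : ℝ) * ∑ g ∈ Finset.univ.filter (· ∈ M), a g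
      = ∑ g : G, (∑ ψ : AddChar (Additive (G ⧸ M)) ℂ, (ψ (Additive.ofMul (g : G ⧸ M))).re) * a g := by
    rw [Finset.mul_sum, Finset.sum_filter]
    refine Finset.sum_congr rfl fun g _ => ?_
    rw [sum_re_addChar_quotient]
    split_ifs <;> simp
  have h2 : ∑ g : G, (∑ ψ : AddChar (Additive (G ⧸ M)) ℂ, (ψ (Additive.ofMul (g : G ⧸ M))).re) * a g
      = ∑ ψ : AddChar (Additive (G ⧸ M)) ℂ, ∑ g : G, (ψ (Additive.ofMul (g : G ⧸ M))).re * a g := by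
    simp_rw [Finset.sum_mul]
    exact Finset.sum_comm
  rw [h1, h2, ← Finset.add_sum_erase _ _ (Finset.mem_univ (0 : AddChar (Additive (G ⧸ M)) ℂ))]
  have h0 : ∑ g : G, ((0 : AddChar (Additive (G ⧸ M)) ℂ) (Additive.ofMul (g : G ⧸ M))).re * a g
      = ∑ g, a g := by
    simp
  rw [h0]
  have hcard : ((Finset.univ.erase (0 : AddChar (Additive (G ⧸ M)) ℂ)).card : ℝ) =
      (M.index : ℝ) - 1 := by
    rw [Finset.card_erase_of_mem (Finset.mem_univ _), Finset.card_univ, card_addChar_quotient,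
      Nat.cast_sub (Nat.one_le_iff_ne_zero.mpr (Subgroup.index_ne_zero_of_finite (H := M))), Nat.cast_one]
  have hrest : ∑ ψ ∈ Finset.univ.erase (0 : AddChar (Additive (G ⧸ M)) ℂ),
      ∑ g : G, (ψ (Additive.ofMul (g : G ⧸ M))).re * a g ≤ ((M.index : ℝ) - 1) * B := by
    calc ∑ ψ ∈ Finset.univ.erase (0 : AddChar (Additive (G ⧸ M)) ℂ),
          ∑ g : G, (ψ (Additive.ofMul (g : G ⧸ M))).re * a g
        ≤ ∑ ψ ∈ Finset.univ.erase (0 : AddChar (Additive (G ⧸ M)) ℂ), B := by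
          refine Finset.sum_le_sum fun ψ hψ => ?_
          have hne : ψ ≠ 0 := Finset.ne_of_mem_erase hψ
          have h := hB (((toMulHom ψ).comp (QuotientGroup.mk' M)).toHomUnits) (liftChar_ne_one M hne)
            (fun g hg => liftChar_apply_of_mem M ψ hg)
          simpa only [MonoidHom.coe_toHomUnits, MonoidHom.comp_apply, QuotientGroup.mk'_apply,
            toMulHom_apply] using h
      _ = ((M.index : ℝ) - 1) * B := by rw [Finset.sum_const, nsmul_eq_mul, hcard]
  linarith

end Orthogonality

end CubicEscape

end Summit.QuantumAdvantage.QuantumAdvantage.Theorems.DegreeOnePrimesEscape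

end
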